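import Summits.QuantumFields.BalabanUV.Beta.EriceFlowEnclosureB12AsPrintedPointwiseFace
import Literature.MathematicalPhysics.QuantumFieldTheory.Balaban1983to89.Beta.AveragedAFCarrier
import Literature.MathematicalPhysics.QuantumFieldTheory.Balaban1983to89.T4OneLoopAsymptotics

/-!
# Beta / EriceFlowEnclosureB12AsPrintedPointwiseFaceDrift — WHAT (0.31) FORCES, part 9b: THE TYPED THEOREM 2 FORCES THE *DRIFT* OF THE FACE SEQUENCE AND THE AVERAGED-AF CARRIER.
# Part 9 (`…PointwiseFace`): through the face g_k = 0 ((2.13)'s printed remark) and the cell's (AF-1) letter, the g-uniform (0.31) bounds the face values pointwise, while the TYPED Theorem 2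
# (constants after g) gives only face_k ≥ 0 (sharp: the ramp family has face_1 = 0).  Here the typed Theorem 2 is read over WINDOWS: on the lattice K with endpoint g, (0.31) at scale k and
# (0.20) telescoped give Σ_{j∈[k,K)} β_{j+1}(r_{≤j}) ∈ [b(K−k), b′(K−k)] with b = β(g) ln L > 0, and (0.31) ALSO makes the tuned run asymptotically free, r_j ≤ (b(K−j))^{−1∕2}, so moving each term to
# the face by (AF-1) costs Σ_j C r_j ≤ 2C√(K−k)∕√b — a √ of the window, not a multiple of it (node U6's `T4OneLoopAsymptotics.sum_inv_sqrt_succ_le`: Σ_{n≤N} n^{−1∕2} ≤ 2√N, BY NAME).  Since the face sequence does not depend on g, ONE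
# admissible endpoint suffices: **`faceDrift_of_theorem2_AF1`** — Theorem 2 AS TYPED + `Definitions` + `hrg` + (AF-1) ⟹ ∃ 0 < b ≤ b′ with `b·N − 2C√N∕√b ≤ Σ_{j∈[k,k+N)} β_{j+1}(·, 0) ≤ b′·N + 2C√N∕√b`
# for ALL windows: the face ∕ «one-loop» sequence has TWO-SIDED LINEAR DRIFT (row D1's drift letter in its Cesàro form, with a √N defect).  And on ]0, γ]-histories β_{j+1} ≥ face_j − Cγ, so
# **`betaAvgAFH_of_theorem2_AF1`**: Theorem 2 AS TYPED + `Definitions` + `hrg` + (AF-1) ⟹ crew CAP's carrier `Beta.AveragedAFCarrier.BetaAvgAFH (b∕2) (4C²∕b²) γ S.β` for all small γ — the letter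
# socket e3's certified slice instantiates is NECESSARY for [I] Theorem 2 EVEN AS TYPED, given (AF-1) (part 6d #60e had it for the UNIFORM reading under fading-memory moduli with defect 0)
# (β-flow team, prover 2 = lower ∕ positivity side, unit `b2b-balaban-beta-bflow-p2`, gen 44; ROW AP-I × row D4's face letter × (AF-1) × crew CAP's carrier; companion of parts 9 ∕ 9 END)

HONEST FRAMING (page 1 of everything the β sub-cell writes): discharging `BetaPertH` makes Bałaban's UV stability UNCONDITIONAL — a
real constructive-QFT result; it is NOT the continuum limit and NOT the Clay problem.  HONEST DEPENDENCY (cell reorg 2026-08-19,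
verbatim): «continuum YM on T⁴ ⇐ BetaPertH ∧ nine spine estimates (0/9 proved); BetaPertH ⇐ (D1) ∧ (D4) ∧ CAP+tail; G-an2-4 gates
asym, D1 and NE2/3/4.»  THIS MODULE DISCHARGES NOTHING: bookkeeping from the NAMED FIELDS of the statement-exact typing `B12BetaAsPrinted` of [I] = T. Bałaban, Commun. Math.
Phys. **109** (1987) [Balaban1987RG1] (`Definitions` incl. the printed (2.13) remark; `Theorem2Statement` — STATED WITHOUT PROOF, p. 259 — a HYPOTHESIS), prover 1's binder `hrg` (or (U)),
the cell's (AF-1) `BetaDerivClause.LastVarLipschitzAtZero` (UNPRINTED k-uniformity) and crew CAP's HYPOTHESIS SHAPE `Beta.AveragedAFCarrier.BetaAvgAFH` (here a CONCLUSION for an abstract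
setting; for Bałaban's (1.22) every instance remains a located UNPRINTED input).  Nothing of Bałaban's one-loop coefficients is asserted.

WHAT THIS FILE PROVES (0 sorry, 0 def): §1 `sum_run_le_of_discrete031` (Σ_{j∈[k,K)} r_j ≤ 2√(K−k)∕√b along a (0.31)-run), **`faceDrift_window`**
(one lattice, one window); §2 **`faceDrift_of_theorem2_AF1`** (all windows, typed Theorem 2), **`betaAvgAFH_of_theorem2_AF1`**, `betaAvgAFH_of_theorem2_AF1'` ((U) discharges `hrg`).
NOT CLAIMED: drift or sign of Bałaban's one-loop coefficients; any letter for Bałaban's β; which reading print intends; Theorem 2; `BetaPertH`; continuum; Clay.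
-/

namespace Summit.QuantumFields.BalabanUV.Beta.EriceFlowEnclosureB12AsPrintedPointwiseFaceDrift

open Finset
open Literature.MathematicalPhysics.QuantumFieldTheory.Balaban1983to89
open Literature.MathematicalPhysics.QuantumFieldTheory.Balaban1983to89.B12BetaAsPrinted
open Literature.MathematicalPhysics.QuantumFieldTheory.Balaban1983to89.FlowStep (HBeta prefixOf Box mem_box box_mono RGEqH BetaUpperH
  histBox_eq_box inv_sq_telescopeH)
open Literature.MathematicalPhysics.QuantumFieldTheory.Balaban1983to89.BetaDerivClause (LastVarLipschitzAtZero)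
open Literature.MathematicalPhysics.QuantumFieldTheory.Balaban1983to89.Beta.AveragedAFCarrier (BetaAvgAFH)
open Summit.QuantumFields.BalabanUV.Beta.EriceFlowEnclosureB12AsPrintedUpper (tunedRuns_of_theorem2Statement)
open Summit.QuantumFields.BalabanUV.Beta.EriceFlowEnclosureB12AsPrintedTunedUpper (hrg_of_betaUpperH prefixOf_mem_box_of_inInterval)
open Literature.MathematicalPhysics.QuantumFieldTheory.Balaban1983to89.T4OneLoopAsymptotics (sum_inv_sqrt_succ_le)
open Summit.QuantumFields.BalabanUV.Beta.EriceFlowEnclosureB12AsPrintedPointwiseFace (face_eq)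

noncomputable section

variable {S : Setting}

/-! ## §1 The square-root law for the error of the face transfer along an asymptotically free run -/

/-- **THE TUNED RUN IS SUMMABLY SMALL OVER A WINDOW**: a positive run with `Step.Discrete031 b b′ K (r_K) r`, b > 0, has r_j ≤ (b(K − j))^{−1∕2} for j < K, hence
`Σ_{j∈[k,K)} r_j ≤ 2√(K − k)∕√b`. [cite: Balaban1987RG1, (0.31) p.259] -/
theorem sum_run_le_of_discrete031 {b b' : ℝ} {K : ℕ} {r : ℕ → ℝ} (hb : 0 < b) (hpos : ∀ i, i ≤ K → 0 < r i)
    (hD : Step.Discrete031 b b' K (r K) r) {k : ℕ} (hk : k ≤ K) :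
    ∑ j ∈ Ico k K, r j ≤ 2 * Real.sqrt ((K : ℝ) - k) / Real.sqrt b := by
  have hsb : 0 < Real.sqrt b := Real.sqrt_pos.mpr hb
  set N : ℕ := K - k with hN
  have hKk : K = k + N := by omega
  -- each term: r (k + i) ≤ (1/√b)·1/√((N-1-i)+1)
  have hterm : ∀ i ∈ range N, r (k + i) ≤ 1 / Real.sqrt b * (1 / Real.sqrt (((N - 1 - i : ℕ) : ℝ) + 1)) := by
    intro i hi
    have hiN : i < N := mem_range.mp hi
    have hle : k + i ≤ K := by omega
    set m : ℝ := ((N - 1 - i : ℕ) : ℝ) + 1 with hm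
    have hm0 : 0 < m := by positivity
    have hcast : (K : ℝ) - ((k + i : ℕ) : ℝ) = m := by
      have : k + i + (N - 1 - i) + 1 = K := by omega
      rw [hm, ← this]; push_cast; ring
    have h := (hD (k + i) hle).1
    rw [hcast] at h
    have hrpos := hpos (k + i) hle
    have hK0 : 0 < 1 / (r K) ^ 2 := by have := hpos K le_rfl; positivity
    have hbm : b * m ≤ 1 / (r (k + i)) ^ 2 := by linarith
    have hr2 : (r (k + i)) ^ 2 ≤ 1 / (b * m) := by
      rw [le_div_iff₀ (by positivity)]
      have := mul_le_mul_of_nonneg_left hbm (sq_nonneg (r (k + i)))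
      rwa [mul_one_div, div_self (pow_ne_zero 2 hrpos.ne')] at this
    calc r (k + i) = Real.sqrt ((r (k + i)) ^ 2) := (Real.sqrt_sq hrpos.le).symm
      _ ≤ Real.sqrt (1 / (b * m)) := Real.sqrt_le_sqrt hr2
      _ = 1 / Real.sqrt b * (1 / Real.sqrt m) := by
          rw [Real.sqrt_div zero_le_one, Real.sqrt_one, Real.sqrt_mul hb.le]; ring
  rw [Finset.sum_Ico_eq_sum_range]
  calc ∑ i ∈ range (K - k), r (k + i) ≤ ∑ i ∈ range N, 1 / Real.sqrt b * (1 / Real.sqrt (((N - 1 - i : ℕ) : ℝ) + 1)) :=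
        Finset.sum_le_sum hterm
    _ = 1 / Real.sqrt b * ∑ i ∈ range N, 1 / Real.sqrt ((i : ℝ) + 1) := by
        rw [Finset.mul_sum, ← Finset.sum_range_reflect (fun i => 1 / Real.sqrt b * (1 / Real.sqrt ((i : ℝ) + 1))) N]
    _ ≤ 1 / Real.sqrt b * (2 * Real.sqrt (N : ℝ)) := mul_le_mul_of_nonneg_left (sum_inv_sqrt_succ_le N) (by positivity)
    _ = 2 * Real.sqrt ((K : ℝ) - k) / Real.sqrt b := by rw [hN, Nat.cast_sub hk]; ring

/-- **ONE LATTICE, ONE WINDOW.**  For a setting with the printed `Definitions`, γ_U ≤ γ, (AF-1) `LastVarLipschitzAtZero S.β C γ_U`: a run r of (0.20) (`RGEqH K`) inside ]0, γ_U] with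
`Step.Discrete031 b b′ K (r_K) r`, b > 0, satisfies for every k ≤ K
`b(K−k) − 2C√(K−k)∕√b ≤ Σ_{j∈[k,K)} β_{j+1}(·, 0) ≤ b′(K−k) + 2C√(K−k)∕√b` (face values at the constant history γ_U — history-free by `face_eq`): telescoped (0.20) + (0.31) at scale k give the
window of the run's β-values, (AF-1) moves each to the face at cost C·r_j, and `sum_run_le_of_discrete031` sums the costs. [cite: Balaban1987RG1, (0.20) p.256, (0.31) p.259, (2.13) p.268, §1 p.264] -/
theorem faceDrift_window (hDef : Definitions S) {γU C b b' : ℝ} (hγUS : γU ≤ S.γ) (hC : 0 ≤ C) (hb : 0 < b)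
    (hAF1 : LastVarLipschitzAtZero S.β C γU) {K : ℕ} {r : ℕ → ℝ} (hrg : RGEqH K S.β r) (hI : Step.InInterval γU K r)
    (hD : Step.Discrete031 b b' K (r K) r) {k : ℕ} (hk : k ≤ K) :
    b * ((K : ℝ) - k) - 2 * C * Real.sqrt ((K : ℝ) - k) / Real.sqrt b ≤
        ∑ j ∈ Ico k K, S.β j (Function.update (fun _ : Fin (j + 1) => γU) (Fin.last j) 0) ∧
      ∑ j ∈ Ico k K, S.β j (Function.update (fun _ : Fin (j + 1) => γU) (Fin.last j) 0) ≤
        b' * ((K : ℝ) - k) + 2 * C * Real.sqrt ((K : ℝ) - k) / Real.sqrt b := by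
  have hγU : 0 < γU := lt_of_lt_of_le (hI 0 (Nat.zero_le K)).1 (hI 0 (Nat.zero_le K)).2
  have hconst : ∀ j : ℕ, (fun _ : Fin (j + 1) => γU) ∈ Box γU j := fun j => mem_box.mpr fun _ => ⟨hγU, le_rfl⟩
  -- telescoped window of the run's β-values, and (0.31) at scale k
  have htel := inv_sq_telescopeH hrg hk le_rfl
  have h31 := hD k hk
  -- per-term transfer to the face
  have hterm : ∀ j ∈ Ico k K, |S.β j (prefixOf r j) - S.β j (Function.update (fun _ : Fin (j + 1) => γU) (Fin.last j) 0)| ≤ C * r j := by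
    intro j hj
    have hjK : j < K := (mem_Ico.mp hj).2
    have hbox : prefixOf r j ∈ Box γU j := prefixOf_mem_box_of_inInterval hI hjK.le
    have h := hAF1 j (prefixOf r j) ((histBox_eq_box γU j).symm ▸ hbox)
    rw [face_eq hDef hγUS hbox (hconst j)] at h
    simpa only [FlowStep.prefixOf_apply, Fin.val_last] using h
  have hsum := sum_run_le_of_discrete031 hb (fun i hi => (hI i hi).1) hD hk
  have habs : |∑ j ∈ Ico k K, S.β j (prefixOf r j) - ∑ j ∈ Ico k K, S.β j (Function.update (fun _ : Fin (j + 1) => γU) (Fin.last j) 0)|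
      ≤ C * ∑ j ∈ Ico k K, r j := by
    rw [← Finset.sum_sub_distrib, Finset.mul_sum]
    exact (Finset.abs_sum_le_sum_abs _ _).trans (Finset.sum_le_sum hterm)
  have hCs : C * ∑ j ∈ Ico k K, r j ≤ 2 * C * Real.sqrt ((K : ℝ) - k) / Real.sqrt b := by
    have := mul_le_mul_of_nonneg_left hsum hC
    calc C * ∑ j ∈ Ico k K, r j ≤ C * (2 * Real.sqrt ((K : ℝ) - k) / Real.sqrt b) := this
      _ = 2 * C * Real.sqrt ((K : ℝ) - k) / Real.sqrt b := by ring
  have h' := abs_le.mp (habs.trans hCs)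
  constructor <;> linarith [h'.1, h'.2, h31.1, h31.2]

/-! ## §2 All windows: the typed Theorem 2 forces two-sided linear drift of the face sequence, and crew CAP's averaged-AF carrier -/

/-- **THE TYPED THEOREM 2 FORCES TWO-SIDED LINEAR DRIFT OF THE FACE SEQUENCE.**  `Theorem2Statement S hL` AS TYPED (constants after g), the printed `Definitions`, prover 1's binder
`hrg` on ]0, γ_U] (γ_U ≤ γ) and (AF-1) `LastVarLipschitzAtZero S.β C γ_U` ⟹ there are 0 < b ≤ b′ (= β(g₁) ln L, β′(g₁) ln L at ONE admissible endpoint — the face sequence does not depend on g) with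
`b·N − 2C√N∕√b ≤ Σ_{j∈[k,k+N)} β_{j+1}(·, 0) ≤ b′·N + 2C√N∕√b` for ALL k, N: the face ∕ «one-loop» values have positive Cesàro drift on long windows (`faceDrift_window` on the lattice K = k + N).
Contrast part 9: pointwise the typed Theorem 2 gives only face ≥ 0. [cite: Balaban1987RG1, Thm 2 (0.31) p.259 with (0.20) p.256, (2.13) p.268 and §1 p.264] -/
theorem faceDrift_of_theorem2_AF1 {hL : Odd S.L ∧ 1 < S.L} (hT : Theorem2Statement S hL) (hDef : Definitions S)
    {γU C : ℝ} (hγU : 0 < γU) (hγUS : γU ≤ S.γ) (hC : 0 ≤ C)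
    (hrg : ∀ P : B12.RunParams, Step.InInterval γU P.K (S.cpl P) → RGEqH P.K S.β (S.cpl P)) (hAF1 : LastVarLipschitzAtZero S.β C γU) :
    ∃ b b' : ℝ, 0 < b ∧ b ≤ b' ∧ ∀ k N : ℕ,
      b * N - 2 * C * Real.sqrt N / Real.sqrt b ≤ ∑ j ∈ Ico k (k + N), S.β j (Function.update (fun _ : Fin (j + 1) => γU) (Fin.last j) 0) ∧
        ∑ j ∈ Ico k (k + N), S.β j (Function.update (fun _ : Fin (j + 1) => γU) (Fin.last j) 0) ≤ b' * N + 2 * C * Real.sqrt N / Real.sqrt b := by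
  have hlog : 0 < Real.log (S.L : ℝ) := Real.log_pos (by exact_mod_cast hL.2)
  obtain ⟨γ₀, hγ₀, hγ⟩ := tunedRuns_of_theorem2Statement hT 0
  obtain ⟨g₁, hg₁, hg⟩ := hγ (min γ₀ γU) (lt_min hγ₀ hγU) (min_le_left _ _)
  obtain ⟨β, β', hβ, hββ', hK⟩ := hg g₁ hg₁ le_rfl
  refine ⟨β * Real.log S.L, β' * Real.log S.L, mul_pos hβ hlog, mul_le_mul_of_nonneg_right hββ' hlog.le, fun k N => ?_⟩
  obtain ⟨g₀, hI, hend, hDisc⟩ := hK (k + N)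
  have hIU : Step.InInterval γU (k + N) (S.cpl ⟨k + N, 0, g₀⟩) := fun i hi => ⟨(hI i hi).1, (hI i hi).2.trans (min_le_right _ _)⟩
  have hDisc' : Step.Discrete031 (β * Real.log S.L) (β' * Real.log S.L) (k + N) (S.cpl ⟨k + N, 0, g₀⟩ (k + N)) (S.cpl ⟨k + N, 0, g₀⟩) := by
    rw [hend]; exact hDisc
  have h := faceDrift_window hDef hγUS hC (mul_pos hβ hlog) hAF1 (hrg ⟨k + N, 0, g₀⟩ hIU) hIU hDisc' (Nat.le_add_right k N)
  have hcast : (((k + N : ℕ) : ℝ) - k) = (N : ℝ) := by push_cast; ring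
  rw [hcast] at h
  exact h

/-- **CREW CAP's AVERAGED-AF CARRIER IS NECESSARY FOR THEOREM 2 EVEN AS TYPED, GIVEN (AF-1).**  Same hypotheses ⟹ for every box size γ ≤ min(γ_U, b∕(4C+1)) (b from `faceDrift_of_theorem2_AF1`):
`BetaAvgAFH (b∕2) (4C²∕b²) γ S.β` — along EVERY ]0, γ]-history the window sums of β obey (b∕2)(n − k) − 4C²∕b² ≤ Σ_{j∈[k,n)} β_{j+1}(g₀, …, g_j) (each term ≥ face − Cγ by (AF-1), the faces drift by
`faceDrift_of_theorem2_AF1`, and 2C√N∕√b ≤ (b∕4)N + 4C²∕b²).  Part 6d (#60e) had the carrier NECESSARY for the g-UNIFORM Theorem 2 under fading-memory moduli; here: the TYPED Theorem 2,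
(AF-1) only, a defect instead of slope loss. [cite: Balaban1987RG1, Thm 2 (0.31) p.259 with (2.13) p.268 and §1 p.264] -/
theorem betaAvgAFH_of_theorem2_AF1 {hL : Odd S.L ∧ 1 < S.L} (hT : Theorem2Statement S hL) (hDef : Definitions S)
    {γU C : ℝ} (hγU : 0 < γU) (hγUS : γU ≤ S.γ) (hC : 0 ≤ C)
    (hrg : ∀ P : B12.RunParams, Step.InInterval γU P.K (S.cpl P) → RGEqH P.K S.β (S.cpl P)) (hAF1 : LastVarLipschitzAtZero S.β C γU) :
    ∃ b : ℝ, 0 < b ∧ ∀ γ : ℝ, 0 < γ → γ ≤ γU → C * γ ≤ b / 4 → BetaAvgAFH (b / 2) (4 * C ^ 2 / b ^ 2) γ S.β := by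
  obtain ⟨b, b', hb, -, hdrift⟩ := faceDrift_of_theorem2_AF1 hT hDef hγU hγUS hC hrg hAF1
  refine ⟨b, hb, fun γ hγ hγU' hCγ g hg k n hkn => ?_⟩
  obtain ⟨N, rfl⟩ : ∃ N, n = k + N := ⟨n - k, by omega⟩
  have hconst : ∀ j : ℕ, (fun _ : Fin (j + 1) => γU) ∈ Box γU j := fun j => mem_box.mpr fun _ => ⟨hγU, le_rfl⟩
  -- each term is ≥ face − Cγ
  have hterm : ∀ j ∈ Ico k (k + N), S.β j (Function.update (fun _ : Fin (j + 1) => γU) (Fin.last j) 0) - C * γ ≤ S.β j (prefixOf g j) := by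
    intro j _
    have hbox : prefixOf g j ∈ Box γU j := mem_box.mpr fun i => ⟨(hg i).1, (hg i).2.trans hγU'⟩
    have h := hAF1 j (prefixOf g j) ((histBox_eq_box γU j).symm ▸ hbox)
    rw [face_eq hDef hγUS hbox (hconst j)] at h
    simp only [FlowStep.prefixOf_apply, Fin.val_last] at h
    have h' := (abs_le.mp h).1
    have hCg : C * g j ≤ C * γ := mul_le_mul_of_nonneg_left (hg j).2 hC
    linarith
  have hlow := (hdrift k N).1
  have hsumterm : ∑ j ∈ Ico k (k + N), (S.β j (Function.update (fun _ : Fin (j + 1) => γU) (Fin.last j) 0) - C * γ) ≤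
      ∑ j ∈ Ico k (k + N), S.β j (prefixOf g j) := Finset.sum_le_sum hterm
  rw [Finset.sum_sub_distrib, Finset.sum_const, Nat.card_Ico, nsmul_eq_mul] at hsumterm
  have hcard : (((k + N - k : ℕ) : ℝ)) = N := by rw [Nat.add_sub_cancel_left]
  rw [hcard] at hsumterm
  -- the √N defect absorbed: 2C√N/√b ≤ (b/4)N + 4C²/b², with u := √N/√b and N = b·u²
  have hsN : Real.sqrt (N : ℝ) ^ 2 = N := Real.sq_sqrt (Nat.cast_nonneg N)
  have hsb2 : Real.sqrt b ^ 2 = b := Real.sq_sqrt hb.le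
  set u : ℝ := Real.sqrt (N : ℝ) / Real.sqrt b with hu
  have hu2 : u ^ 2 = (N : ℝ) / b := by rw [hu, div_pow, hsN, hsb2]
  have hNu : (N : ℝ) = b * u ^ 2 := by rw [hu2]; field_simp
  have habsorb : 2 * C * Real.sqrt N / Real.sqrt b ≤ b / 4 * N + 4 * C ^ 2 / b ^ 2 := by
    have e1 : 2 * C * Real.sqrt N / Real.sqrt b = 2 * C * u := by rw [hu]; ring
    have e2 : (b * u / 2 - 2 * C / b) ^ 2 = b ^ 2 * u ^ 2 / 4 - 2 * C * u + 4 * C ^ 2 / b ^ 2 := by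
      field_simp; ring
    rw [e1, hNu]
    nlinarith [sq_nonneg (b * u / 2 - 2 * C / b), e2]
  have hNC : (N : ℝ) * (C * γ) ≤ (N : ℝ) * (b / 4) := mul_le_mul_of_nonneg_left hCγ (Nat.cast_nonneg N)
  have hcastN : (((k + N : ℕ) : ℝ) - k) = (N : ℝ) := by push_cast; ring
  rw [hcastN]
  linarith [hlow, hsumterm, habsorb, hNC]

/-- The same with prover 1's binder `hrg` DISCHARGED from the upper letter (U) `β_{k+1} ≤ b′` on ]0, γ_U]^{k+1} with b′γ_U² < 1. [cite: Balaban1987RG1, Thm 2 (0.31) p.259 with §1 p.264] -/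
theorem betaAvgAFH_of_theorem2_AF1' {hL : Odd S.L ∧ 1 < S.L} (hT : Theorem2Statement S hL) (hDef : Definitions S)
    {γU C M : ℝ} (hγU : 0 < γU) (hγUS : γU ≤ S.γ) (hC : 0 ≤ C) (hub : BetaUpperH M γU S.β) (hsmall : M * γU ^ 2 < 1)
    (hAF1 : LastVarLipschitzAtZero S.β C γU) :
    ∃ b : ℝ, 0 < b ∧ ∀ γ : ℝ, 0 < γ → γ ≤ γU → C * γ ≤ b / 4 → BetaAvgAFH (b / 2) (4 * C ^ 2 / b ^ 2) γ S.β :=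
  betaAvgAFH_of_theorem2_AF1 hT hDef hγU hγUS hC (hrg_of_betaUpperH hDef hγU hub hsmall) hAF1

end

end Summit.QuantumFields.BalabanUV.Beta.EriceFlowEnclosureB12AsPrintedPointwiseFaceDrift
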